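import Mathlib
import Summits.ResolutionOfSingularities.ResolutionOfSingularities.Theorems.WeightedInvariantLocalWeightedDropMonicDescentBridgeCharts
import Summits.ResolutionOfSingularities.ResolutionOfSingularities.Theorems.WeightedInvariantLocalWeightedDropMonicDescentBridgeMobius
import Summits.ResolutionOfSingularities.ResolutionOfSingularities.Theorems.WeightedInvariantLocalWeightedDropMonicDescentBridgeHyperbolic
import Summits.ResolutionOfSingularities.ResolutionOfSingularities.Theorems.WeightedInvariantLocalWeightedDropMonicDescentTailPointStep
import Summits.ResolutionOfSingularities.ResolutionOfSingularities.Theorems.WeightedInvariantLocalWeightedDropMonicDescentBlowOneLaws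
import Summits.ResolutionOfSingularities.ResolutionOfSingularities.Theorems.WeightedInvariantLocalWeightedDropMonicDescentTransportLaws
import Summits.ResolutionOfSingularities.ResolutionOfSingularities.Theorems.WeightedInvariantLocalWeightedDropMonicDescentShearNewton
import Summits.ResolutionOfSingularities.ResolutionOfSingularities.Theorems.WeightedInvariantLocalWeightedDropMonicDescentBetaStep
import Summits.ResolutionOfSingularities.ResolutionOfSingularities.Theorems.WeightedInvariantLocalWeightedDropMonicDescentSlices

/-!
# `WeightedInvariant.LocalWeightedDrop`, sub-stub `stub_monicDoublePointDescends`: PIECE T-6′ — THE GAME BRIDGE for the strategy Σ**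

Crux item stmt-ResolutionOfSingularities-8899 `LocalWeightedDrop` (route `ResolutionOfSingularities/WeightedInvariant`), door
`HypersurfaceCentreConstruction` stmt-ResolutionOfSingularities-19897.  [OURS · L1 W4.3, chain w43, seat res-type-056 (T-6′ per SEAT TABLE v6).
Nothing here is a statement of any manuscript.]

`monicDescentBridge` = the hypothesis hT6 of `MonicDescent.descends_of_pieces` (p488513), in the registered conditional form (first hypothesis =
T-1′, now `MonicDescent.monicDescentPrep`): at every WELL-PREPARED REDUCED POSITION `B` the move of the strategy Σ** (`succLabels B`) satisfies
the clauses of the descent game — after a formal re-presentation `B′` of `pos B` (a shear + preparation in case (a″), else `B′ = B`) and no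
re-centring (`φ = 0`), the move is the blow-up of `V(y,u₁)` / `V(y,u₂)` / of the sheared-prepared `V(y,ũ₂)` / the point, and EVERY SINGULAR SLICE
offered by the Refuter is hyperbolic or formally re-presented by a WELL-PREPARED POSITION among the successor labels.  Ingredients:
the five slice re-presentations of `…BridgeCharts` / `…BridgeMobius`, the hyperbolic exit `isPosition_or_isHyperbolic_of_represents` of
`…BridgeHyperbolic`, persistence of well-preparedness under the transports (`wellPrepared_blowOne/blowTwo/divOne/divTwo`), and
`blowOneLabel (prep Y) = recentre (blowOne 1 ψ) (blowOneLabel Y)`, `ψ` the preparing series (no linear terms: `coeff_single_eq_zero_of_recentre_isPosition`).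
With T-1′ `monicDescentPrep` and T-5′ `monicDescentNoChain` this closes the registered stub `stub_monicDoublePointDescends` BY NAME (`descends_of_pieces`).
-/

set_option linter.dupNamespace false -- mandated namespace of this single-conjunct summit

noncomputable section

namespace Summit.ResolutionOfSingularities.ResolutionOfSingularities.Theorems

namespace MonicDescent

open MvPowerSeries Literature.RingTheory.TwoVariableSeries Literature.AlgebraicGeometry.Resolution

variable {k : Type} [Field k]

/-! ## Small tools -/

/-- The preparing series of a position has no linear terms: if `A` and `recentre ψ A` are positions then `coeff u_i ψ = 0`
(in characteristic `2`, `coeff (2eᵢ) ψ² = (coeff eᵢ ψ)²` while `A₀`, `A₁ψ` have order `≥ 3`). -/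
theorem coeff_single_eq_zero_of_recentre_isPosition [CharP k 2] {A₀ A₁ ψ : MvPowerSeries (Fin 2) k} (hA : IsPosition A₀ A₁)
    (hψ : constantCoeff ψ = 0) (hA' : IsPosition (recentre ψ A₀ A₁).1 (recentre ψ A₀ A₁).2) (i : Fin 2) :
    coeff (Finsupp.single i 1) ψ = 0 := by
  have hdeg2 : ((2 • Finsupp.single i 1 : Fin 2 →₀ ℕ).degree : ℕ∞) = 2 := by
    rw [map_nsmul, Finsupp.degree_single]; rfl
  have h3 : coeff (2 • Finsupp.single i 1) (A₀ + A₁ * ψ + ψ ^ 2) = 0 := by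
    apply coeff_of_lt_order
    rw [hdeg2]
    exact hA'.1
  have h0 : coeff (2 • Finsupp.single i 1) A₀ = 0 := by
    apply coeff_of_lt_order
    rw [hdeg2]
    exact hA.1
  have hψ1 : (1 : ℕ∞) ≤ ψ.order := by
    apply MvPowerSeries.nat_le_order
    intro d hd
    have : d = 0 := (Finsupp.degree_eq_zero_iff d).mp (by omega)
    rw [this, coeff_zero_eq_constantCoeff_apply, hψ]
  have h1 : coeff (2 • Finsupp.single i 1) (A₁ * ψ) = 0 := by
    apply coeff_of_lt_order
    rw [hdeg2]
    calc (2 : ℕ∞) < 2 + 1 := by norm_num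
      _ ≤ A₁.order + ψ.order := add_le_add (Order.add_one_le_of_lt hA.2) hψ1
      _ ≤ (A₁ * ψ).order := MvPowerSeries.le_order_mul
  rw [map_add, map_add, h0, h1, zero_add, zero_add, coeff_two_smul_sq] at h3
  exact pow_eq_zero_iff (two_ne_zero) |>.mp h3

/-- For a position `Y` with preparing series `ψ` (T-1′), the `u₁`-chart of the prepared label is a RE-CENTRING of the `u₁`-chart of `Y`:
`blowOneLabel (prep Y) = recentre (blowOne 1 ψ) (blowOneLabel Y)`, with `blowOne 1 ψ` vanishing at the origin. -/
theorem blowOneLabel_prep_eq [CharP k 2] {Y : Label k} (hY : IsPosition Y.1 Y.2) (hprep : IsPrepRecentring Y.1 Y.2 (prepPsi Y.1 Y.2)) :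
    constantCoeff (blowOne 1 (prepPsi Y.1 Y.2)) = 0 ∧
      blowOneLabel (prep Y) = recentre (blowOne 1 (prepPsi Y.1 Y.2)) (blowOneLabel Y).1 (blowOneLabel Y).2 := by
  obtain ⟨hψ0, hpos', -, -⟩ := hprep
  have hlin := coeff_single_eq_zero_of_recentre_isPosition hY hψ0 hpos'
  have hψ1 : (1 : ℕ∞) ≤ (prepPsi Y.1 Y.2).order := by
    apply MvPowerSeries.nat_le_order
    intro d hd
    have : d = 0 := (Finsupp.degree_eq_zero_iff d).mp (by omega)
    rw [this, coeff_zero_eq_constantCoeff_apply, hψ0]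
  constructor
  · rw [← coeff_zero_eq_constantCoeff_apply, coeff_blowOne, if_pos (by simp)]
    have : Finsupp.single 0 ((0 : Fin 2 →₀ ℕ) 0 + 1 - (0 : Fin 2 →₀ ℕ) 1) + Finsupp.single 1 ((0 : Fin 2 →₀ ℕ) 1) =
        (Finsupp.single 0 1 : Fin 2 →₀ ℕ) := by simp
    rw [this]
    exact hlin 0
  · unfold blowOneLabel prep recentre
    ext1
    · exact blowOne_recentre Y.1 Y.2 _ hY.1.le hY.2.le hψ1
    · show blowOne 1 (Y.2 + 2 * prepPsi Y.1 Y.2) = blowOne 1 Y.2 + 2 * blowOne 1 (prepPsi Y.1 Y.2)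
      rw [two_eq_zero, zero_mul, zero_mul, add_zero, add_zero]

/-- On a well-prepared position with `V(y,u₁)` permissible, `u₁²` does not occur in `B₀` (else `(2,0)` is a non-odd vertex). -/
theorem coeff_two_zero_eq_zero {B₀ B₁ : MvPowerSeries (Fin 2) k} (hWP : WellPrepared B₀ B₁) (hpos : IsPosition B₀ B₁)
    (hP1 : IsPermissibleOne B₀ B₁) : coeff (Finsupp.single 0 2) B₀ = 0 := by
  by_contra hne
  have hN := two_le_fst_of_isPermissibleOne hP1
  have hv : IsVertex (newtonSet B₀ B₁) (Finsupp.single 0 2) := by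
    refine ⟨Or.inl hne, ![1, 3], by intro i; fin_cases i <;> simp, ?_⟩
    intro Q hQ hQne
    have hw : ∀ R : Fin 2 →₀ ℕ, Finsupp.weight ![1, 3] R = R 0 + 3 * R 1 := by
      intro R
      rw [Finsupp.weight_apply, Finsupp.sum_fintype _ _ (by simp), Fin.sum_univ_two]
      simp [mul_comm]
    rw [hw, hw]
    have hQ0 := hN Q hQ
    have : Q 0 ≠ 2 ∨ Q 1 ≠ 0 := by
      by_contra h
      push Not at h
      exact hQne (finsupp_fin2_ext (by simp [h.1]) (by simp [h.2]))
    simp only [Finsupp.single_apply]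
    simp
    omega
  rcases hWP _ hv with ⟨e, he, hcoef⟩ | ⟨-, i, hi⟩
  · apply hcoef
    have he' : e = Finsupp.single 0 1 := by
      have h0 := congrArg (fun P => P 0) he
      have h1 := congrArg (fun P => P 1) he
      simp at h0 h1
      exact finsupp_fin2_ext (by simp; omega) (by simp; omega)
    rw [he']
    apply coeff_of_lt_order
    rw [Finsupp.degree_single]
    exact hpos.2
  · fin_cases i <;> simp at hi

/-- Mirror: with `V(y,u₂)` permissible, `u₂²` does not occur in `B₀`. -/
theorem coeff_zero_two_eq_zero {B₀ B₁ : MvPowerSeries (Fin 2) k} (hWP : WellPrepared B₀ B₁) (hpos : IsPosition B₀ B₁)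
    (hP2 : IsPermissibleTwo B₀ B₁) : coeff (Finsupp.single 1 2) B₀ = 0 := by
  by_contra hne
  have hN := two_le_snd_of_isPermissibleTwo hP2
  have hv : IsVertex (newtonSet B₀ B₁) (Finsupp.single 1 2) := by
    refine ⟨Or.inl hne, ![3, 1], by intro i; fin_cases i <;> simp, ?_⟩
    intro Q hQ hQne
    have hw : ∀ R : Fin 2 →₀ ℕ, Finsupp.weight ![3, 1] R = 3 * R 0 + R 1 := by
      intro R
      rw [Finsupp.weight_apply, Finsupp.sum_fintype _ _ (by simp), Fin.sum_univ_two]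
      simp [mul_comm]
    rw [hw, hw]
    have hQ1 := hN Q hQ
    have : Q 1 ≠ 2 ∨ Q 0 ≠ 0 := by
      by_contra h
      push Not at h
      exact hQne (finsupp_fin2_ext (by simp [h.2]) (by simp [h.1]))
    simp only [Finsupp.single_apply]
    simp
    omega
  rcases hWP _ hv with ⟨e, he, hcoef⟩ | ⟨-, i, hi⟩
  · apply hcoef
    have he' : e = Finsupp.single 1 1 := by
      have h0 := congrArg (fun P => P 0) he
      have h1 := congrArg (fun P => P 1) he
      simp at h0 h1
      exact finsupp_fin2_ext (by simp; omega) (by simp; omega)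
    rw [he']
    apply coeff_of_lt_order
    rw [Finsupp.degree_single]
    exact hpos.2
  · fin_cases i <;> simp at hi

/-- The goodness predicate of the bridge follows from a re-presentation by a WELL-PREPARED successor label (hyperbolic exit otherwise). -/
theorem good_of_represents [CharP k 2] [IsAlgClosed k] {B A' : Label k} (hA' : A' ∈ succLabels B) (hWP' : WellPrepared A'.1 A'.2)
    {S : MvPowerSeries (Fin 3) k} (hS : CobordantGame.IsSingular k S) (hrep : Represents S A'.1 A'.2) :
    IsHyperbolic S ∨ ∃ A' ∈ succLabels B, IsPosition A'.1 A'.2 ∧ WellPrepared A'.1 A'.2 ∧ Represents S A'.1 A'.2 := by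
  rcases isPosition_or_isHyperbolic_of_represents hWP' hS hrep with hposA | hhyp
  · exact Or.inr ⟨A', hA', hposA, hWP', hrep⟩
  · exact Or.inl hhyp

/-! ## The curve clauses -/

/-- CASE (a′), `V(y,u₁)` permissible: the curve clause holds with successor `divOneLabel B`. -/
theorem curveClause_one [CharP k 2] [IsAlgClosed k] {B : Label k} (hWP : WellPrepared B.1 B.2) (hpos : IsPosition B.1 B.2)
    (hP1 : IsPermissibleOne B.1 B.2) (hmem : divOneLabel B ∈ succLabels B) :
    CurveClause B.1 B.2 0 (fun S => IsHyperbolic S ∨ ∃ A' ∈ succLabels B,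
      IsPosition A'.1 A'.2 ∧ WellPrepared A'.1 A'.2 ∧ Represents S A'.1 A'.2) := by
  have hWP' : WellPrepared (divOneLabel B).1 (divOneLabel B).2 :=
    wellPrepared_divOne B.1 B.2 (two_le_fst_of_isPermissibleOne hP1) hWP
  refine ⟨0, ![divOne 2 B.1, divOne 1 B.2], ?_, ?_, ?_⟩
  · intro j
    fin_cases j
    · show B.1 + B.2 * 0 + 0 ^ 2 = X 0 ^ (2 - 0) * divOne 2 B.1
      rw [mul_zero, add_zero, sq, mul_zero, add_zero, Nat.sub_zero, X_pow_mul_divOne 2 B.1 hP1.1]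
    · show B.2 + 2 * 0 = X 0 ^ (2 - 1) * divOne 1 B.2
      rw [mul_zero, add_zero, show 2 - 1 = 1 from rfl, pow_one, ← pow_one (X 0 : MvPowerSeries (Fin 2) k),
        X_pow_mul_divOne 1 B.2 hP1.2]
  · intro j
    fin_cases j
    · show constantCoeff (divOne 2 B.1) = 0
      rw [← coeff_zero_eq_constantCoeff_apply, coeff_divOne, zero_add]
      exact coeff_two_zero_eq_zero hWP hpos hP1
    · show constantCoeff (divOne 1 B.2) = 0
      rw [← coeff_zero_eq_constantCoeff_apply, coeff_divOne, zero_add]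
      apply coeff_of_lt_order
      rw [Finsupp.degree_single]
      exact hpos.2
  · intro ci hci S hS hsing
    have hrep : Represents S (divOne 2 B.1) (divOne 1 B.2) := by
      rw [hS, clauseSum_eq_pos]
      simp only [Fin.val_zero, Fin.val_one, Nat.sub_zero, Nat.add_one_sub_one, pow_one, Matrix.cons_val_zero,
        Matrix.cons_val_one]
      exact represents_curveSlice_zero (divOne 2 B.1) (divOne 1 B.2) ci hci
    exact good_of_represents hmem hWP' hsing hrep

/-- CASE `V(y,u₂)` permissible: the curve clause holds with successor `divTwoLabel B`. -/
theorem curveClause_two [CharP k 2] [IsAlgClosed k] {B B₀ : Label k} (hWP : WellPrepared B.1 B.2) (hpos : IsPosition B.1 B.2)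
    (hP2 : IsPermissibleTwo B.1 B.2) (hmem : divTwoLabel B ∈ succLabels B₀) :
    CurveClause B.1 B.2 0 (fun S => IsHyperbolic S ∨ ∃ A' ∈ succLabels B₀,
      IsPosition A'.1 A'.2 ∧ WellPrepared A'.1 A'.2 ∧ Represents S A'.1 A'.2) := by
  have hWP' : WellPrepared (divTwoLabel B).1 (divTwoLabel B).2 :=
    wellPrepared_divTwo B.1 B.2 (two_le_snd_of_isPermissibleTwo hP2) hWP
  refine ⟨1, ![divTwo 2 B.1, divTwo 1 B.2], ?_, ?_, ?_⟩
  · intro j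
    fin_cases j
    · show B.1 + B.2 * 0 + 0 ^ 2 = X 1 ^ (2 - 0) * divTwo 2 B.1
      rw [mul_zero, add_zero, sq, mul_zero, add_zero, Nat.sub_zero, X_pow_mul_divTwo 2 B.1 hP2.1]
    · show B.2 + 2 * 0 = X 1 ^ (2 - 1) * divTwo 1 B.2
      rw [mul_zero, add_zero, show 2 - 1 = 1 from rfl, pow_one, ← pow_one (X 1 : MvPowerSeries (Fin 2) k),
        X_pow_mul_divTwo 1 B.2 hP2.2]
  · intro j
    fin_cases j
    · show constantCoeff (divTwo 2 B.1) = 0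
      rw [← coeff_zero_eq_constantCoeff_apply, coeff_divTwo, zero_add]
      exact coeff_zero_two_eq_zero hWP hpos hP2
    · show constantCoeff (divTwo 1 B.2) = 0
      rw [← coeff_zero_eq_constantCoeff_apply, coeff_divTwo, zero_add]
      apply coeff_of_lt_order
      rw [Finsupp.degree_single]
      exact hpos.2
  · intro ci hci S hS hsing
    have hrep : Represents S (divTwo 2 B.1) (divTwo 1 B.2) := by
      rw [hS, clauseSum_eq_pos]
      simp only [Fin.val_zero, Fin.val_one, Nat.sub_zero, Nat.add_one_sub_one, pow_one, Matrix.cons_val_zero,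
        Matrix.cons_val_one]
      exact represents_curveSlice_one (divTwo 2 B.1) (divTwo 1 B.2) ci hci
    exact good_of_represents hmem hWP' hsing hrep

/-! ## The point clause -/

/-- The `λ`-branch of the point clause: a slice re-presented by `blowOneLabel (shearLabel (C λ) B)`, `λ ≠ 0`, is good — it is re-presented by the
WELL-PREPARED successor `blowOneLabel (prep (shearLabel (C λ) B))` (T-1′ supplies the preparation). -/
theorem good_of_represents_shear [CharP k 2] [IsAlgClosed k]
    (hT1 : ∀ (k : Type) [Field k] [CharP k 2] [IsAlgClosed k] (A₀ A₁ : MvPowerSeries (Fin 2) k),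
      IsPosition A₀ A₁ → ∃ ψ : MvPowerSeries (Fin 2) k, IsPrepRecentring A₀ A₁ ψ)
    {B : Label k} (hpos : IsPosition B.1 B.2) {lam : k}
    (hmem : blowOneLabel (prep (shearLabel (C lam) B)) ∈ succLabels B) {S : MvPowerSeries (Fin 3) k}
    (hS : CobordantGame.IsSingular k S) (hrep : Represents S (blowOne 2 (shear (C lam) B.1)) (blowOne 1 (shear (C lam) B.2))) :
    IsHyperbolic S ∨ ∃ A' ∈ succLabels B, IsPosition A'.1 A'.2 ∧ WellPrepared A'.1 A'.2 ∧ Represents S A'.1 A'.2 := by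
  set Y : Label k := shearLabel (C lam) B with hY
  have hYpos : IsPosition Y.1 Y.2 := isPosition_shearLabel _ hpos
  have hprep := isPrepRecentring_prepPsi (hT1 k Y.1 Y.2 hYpos)
  obtain ⟨hψ'0, heq⟩ := blowOneLabel_prep_eq hYpos hprep
  obtain ⟨-, hposP, hWPP, -⟩ := hprep
  have hWP' : WellPrepared (blowOneLabel (prep Y)).1 (blowOneLabel (prep Y)).2 :=
    wellPrepared_blowOne _ _ (two_le_sum_of_isPosition hposP) hWPP
  have hrep' : Represents S (blowOneLabel (prep Y)).1 (blowOneLabel (prep Y)).2 := by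
    rw [heq]
    exact represents_trans hrep (represents_recentre _ _ _ hψ'0)
  exact good_of_represents hmem hWP' hS hrep'

/-- CASE (b), the point blow-up: the point clause holds (successors `blowOneLabel B`, `blowTwoLabel B`, `blowOneLabel (prep (shear_λ B))`). -/
theorem pointClause [CharP k 2] [IsAlgClosed k]
    (hT1 : ∀ (k : Type) [Field k] [CharP k 2] [IsAlgClosed k] (A₀ A₁ : MvPowerSeries (Fin 2) k),
      IsPosition A₀ A₁ → ∃ ψ : MvPowerSeries (Fin 2) k, IsPrepRecentring A₀ A₁ ψ)
    {B : Label k} (hWP : WellPrepared B.1 B.2) (hpos : IsPosition B.1 B.2)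
    (hmem₁ : blowOneLabel B ∈ succLabels B) (hmem₂ : blowTwoLabel B ∈ succLabels B)
    (hmem₃ : ∀ c : k, c ≠ 0 → blowOneLabel (prep (shearLabel (C c) B)) ∈ succLabels B) :
    PointClause B.1 B.2 0 (fun S => IsHyperbolic S ∨ ∃ A' ∈ succLabels B,
      IsPosition A'.1 A'.2 ∧ WellPrepared A'.1 A'.2 ∧ Represents S A'.1 A'.2) := by
  intro c i₀ hci₀ Bv hBv S hS hsing
  have hBv' : ∀ j : Fin 2, subst (CobordantChart.chart (fun _ : Fin 2 => 1) c) ((![B.1, B.2] : Fin 2 → MvPowerSeries (Fin 2) k) j) =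
      X 0 ^ (2 - (j : ℕ) + 1) * Bv j := by
    have hpair : (![B.1 + B.2 * 0 + 0 ^ 2, B.2 + 2 * 0] : Fin 2 → MvPowerSeries (Fin 2) k) = ![B.1, B.2] := by
      rw [mul_zero, add_zero, sq, mul_zero, add_zero, mul_zero, add_zero]
    intro j
    rw [← hpair]
    exact hBv j
  have hN := two_le_sum_of_isPosition hpos
  rw [hS, clauseSum_eq_pos] at hsing ⊢
  fin_cases i₀
  · -- slice y′₀ = 0, c 0 ≠ 0
    have hrep0 := represents_pointSlice_zero hpos c hci₀ Bv hBv'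
    by_cases hc1 : c 1 = 0
    · rw [hc1, zero_div, map_zero, shear_zero_eq, shear_zero_eq] at hrep0
      exact good_of_represents hmem₁ (wellPrepared_blowOne _ _ hN hWP) hsing hrep0
    · exact good_of_represents_shear hT1 hpos (hmem₃ _ (div_ne_zero hc1 hci₀)) hsing hrep0
  · -- slice y′₁ = 0, c 1 ≠ 0
    by_cases hc0 : c 0 = 0
    · have hrep := represents_pointSlice_one_of_eq_zero hpos c hc0 hci₀ Bv hBv'
      exact good_of_represents hmem₂ (wellPrepared_blowTwo _ _ hN hWP) hsing hrep
    · have hrep0 := represents_pointSlice_one hpos c hc0 hci₀ Bv hBv'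
      exact good_of_represents_shear hT1 hpos (hmem₃ _ (div_ne_zero hci₀ hc0)) hsing hrep0

/-! ## T-6′ -/

/-- PIECE T-6′ OF THE N4″ LINE (OURS · L1 W4.3): THE GAME BRIDGE FOR Σ**, = hypothesis hT6 of `MonicDescent.descends_of_pieces`, conditional on
T-1′ (its first hypothesis; discharged by `monicDescentPrep`).  At a well-prepared reduced position `B`: (a′) `V(y,u₁)` permissible ⇒ curve move on
`B` itself; else `V(y,u₂)` permissible ⇒ curve move; (a″) else a graph curve ⇒ re-present `pos B` by `B′ = prep (shearLabel (graphShear B) B)` (shear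
+ preparation are re-presentations) and blow up `V(y,u₂)` there; (b) else the point blow-up.  In each case every singular slice is re-presented by
the transported label (`…BridgeCharts`, `…BridgeMobius`), which is well prepared (persistence) and hence a position or the slice is hyperbolic
(`…BridgeHyperbolic`). -/
theorem monicDescentBridge
    (hT1 : ∀ (k : Type) [Field k] [CharP k 2] [IsAlgClosed k] (A₀ A₁ : MvPowerSeries (Fin 2) k),
      IsPosition A₀ A₁ → ∃ ψ : MvPowerSeries (Fin 2) k, IsPrepRecentring A₀ A₁ ψ) :
    ∀ (k : Type) [Field k] [CharP k 2] [IsAlgClosed k] (B : Label k),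
      WellPrepared B.1 B.2 → IsPosition B.1 B.2 → ¬ IsDoublePlane B.1 B.2 →
      ∃ (B' : Label k) (φ : MvPowerSeries (Fin 2) k), constantCoeff φ = 0 ∧
        IsPosition B'.1 B'.2 ∧
        IsPosition (recentre φ B'.1 B'.2).1 (recentre φ B'.1 B'.2).2 ∧
        Represents (pos B.1 B.2) B'.1 B'.2 ∧
        (PointClause B'.1 B'.2 φ (fun S => IsHyperbolic S ∨ ∃ A' ∈ succLabels B,
            IsPosition A'.1 A'.2 ∧ WellPrepared A'.1 A'.2 ∧ Represents S A'.1 A'.2) ∨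
         CurveClause B'.1 B'.2 φ (fun S => IsHyperbolic S ∨ ∃ A' ∈ succLabels B,
            IsPosition A'.1 A'.2 ∧ WellPrepared A'.1 A'.2 ∧ Represents S A'.1 A'.2)) := by
  intro k _ _ _ B hWP hpos _hred
  by_cases hP1 : IsPermissibleOne B.1 B.2
  · -- (a′) blow up V(y, u₁)
    have hmem : divOneLabel B ∈ succLabels B := by
      unfold succLabels; rw [if_pos hP1]; exact Set.mem_singleton _
    refine ⟨B, 0, map_zero _, hpos, by rw [recentre_zero]; exact hpos, represents_refl B.1 B.2, Or.inr ?_⟩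
    exact curveClause_one hWP hpos hP1 hmem
  by_cases hP2 : IsPermissibleTwo B.1 B.2
  · -- blow up V(y, u₂)
    have hmem : divTwoLabel B ∈ succLabels B := by
      unfold succLabels; rw [if_neg hP1, if_pos hP2]; exact Set.mem_singleton _
    refine ⟨B, 0, map_zero _, hpos, by rw [recentre_zero]; exact hpos, represents_refl B.1 B.2, Or.inr ?_⟩
    exact curveClause_two hWP hpos hP2 hmem
  by_cases hG : HasGraphCurve B
  · -- (a″) a graph curve: shear, prepare, blow up V(y, ũ₂)
    have hmem : divTwoLabel (prep (shearLabel (graphShear B) B)) ∈ succLabels B := by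
      unfold succLabels; rw [if_neg hP1, if_neg hP2, if_pos hG]; exact Set.mem_singleton _
    have hspec : ∃ ψ : MvPowerSeries (Fin 2) k, (∀ e : Fin 2 →₀ ℕ, e 1 ≠ 0 → coeff e (graphShear B) = 0) ∧ constantCoeff ψ = 0 ∧
        IsPermissibleTwo (recentre ψ (shear (graphShear B) B.1) (shear (graphShear B) B.2)).1
          (recentre ψ (shear (graphShear B) B.1) (shear (graphShear B) B.2)).2 := by
      obtain ⟨h, hh⟩ := hG
      exact Classical.epsilon_spec (p := fun h : MvPowerSeries (Fin 2) k => ∃ ψ : MvPowerSeries (Fin 2) k,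
        (∀ e : Fin 2 →₀ ℕ, e 1 ≠ 0 → coeff e h = 0) ∧ constantCoeff ψ = 0 ∧
        IsPermissibleTwo (recentre ψ (shear h B.1) (shear h B.2)).1 (recentre ψ (shear h B.1) (shear h B.2)).2) ⟨h, hh⟩
    obtain ⟨ψ', -, -, hperm'⟩ := hspec
    set Y : Label k := shearLabel (graphShear B) B with hY
    have hYpos : IsPosition Y.1 Y.2 := isPosition_shearLabel _ hpos
    have hprep := isPrepRecentring_prepPsi (hT1 k Y.1 Y.2 hYpos)
    have hP2' : IsPermissibleTwo (prep Y).1 (prep Y).2 := isPermissibleTwo_prep_shear hperm' hprep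
    obtain ⟨hψ0, hposP, hWPP, -⟩ := hprep
    refine ⟨prep Y, 0, map_zero _, hposP, by rw [recentre_zero]; exact hposP, ?_, Or.inr ?_⟩
    · exact represents_trans (represents_shear (graphShear B) B.1 B.2) (represents_recentre _ _ _ hψ0)
    · exact curveClause_two hWPP hposP hP2' hmem
  · -- (b) the point blow-up
    have hsucc : succLabels B = {blowOneLabel B, blowTwoLabel B} ∪
        {X | ∃ c : k, c ≠ 0 ∧ X = blowOneLabel (prep (shearLabel (C c) B))} := by
      unfold succLabels; rw [if_neg hP1, if_neg hP2, if_neg hG]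
    refine ⟨B, 0, map_zero _, hpos, by rw [recentre_zero]; exact hpos, represents_refl B.1 B.2, Or.inl ?_⟩
    refine pointClause hT1 hWP hpos ?_ ?_ ?_
    · rw [hsucc]; exact Set.mem_union_left _ (Set.mem_insert _ _)
    · rw [hsucc]; exact Set.mem_union_left _ (Set.mem_insert_of_mem _ (Set.mem_singleton _))
    · intro c hc; rw [hsucc]; exact Set.mem_union_right _ ⟨c, hc, rfl⟩

/-- CONSEQUENCE (shape check against the composition): with T-1′ and T-5′ as hypotheses, T-6′ gives the conclusion of the registered stub
`stub_monicDoublePointDescends` — every reduced position descends (`descends_of_pieces hT1 (monicDescentBridge hT1) hT5`). -/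
theorem descends_of_prep_of_noChain
    (hT1 : ∀ (k : Type) [Field k] [CharP k 2] [IsAlgClosed k] (A₀ A₁ : MvPowerSeries (Fin 2) k),
      IsPosition A₀ A₁ → ∃ ψ : MvPowerSeries (Fin 2) k, IsPrepRecentring A₀ A₁ ψ)
    (hT5 : ∀ (k : Type) [Field k] [CharP k 2] [IsAlgClosed k],
      ¬ ∃ A : ℕ → Label k, ∀ m, WellPrepared (A m).1 (A m).2 ∧ IsPosition (A m).1 (A m).2 ∧
        ¬ IsDoublePlane (A m).1 (A m).2 ∧ A (m + 1) ∈ succLabels (A m)) :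
    ∀ (k : Type) [Field k] [CharP k 2] [IsAlgClosed k] (A₀ A₁ : MvPowerSeries (Fin 2) k),
      IsPosition A₀ A₁ → ¬ IsDoublePlane A₀ A₁ → Descends A₀ A₁ :=
  descends_of_pieces hT1 (monicDescentBridge hT1) hT5

end MonicDescent

end Summit.ResolutionOfSingularities.ResolutionOfSingularities.Theorems

end
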